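import Summits.QuantumFields.QCD.Theses.SpectralDefectExtinction
import Literature.MathematicalPhysics.QuantumFieldTheory.QCDPhaseQuenched
import Literature.MathematicalPhysics.QuantumFieldTheory.SpectralDefectDensity
import Literature.Barriers.QuantumFields.WilsonDeterminantMassSplitting

/-!
# Crux `WegnerEstimate` (item stmt-QuantumFields-8966), line `Sketch` (skeleton "ResolventCell", gen 2b): definitions

Proof-side vocabulary of the CURRENT-RIGIDITY reduction, single-sourced here so that the stub files
`SpectralDefectExtinctionWegnerEstimateStubBad*.lean` and the line skeleton (`Cruxes/WegnerEstimate/Lines/Sketch.lean`)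
share ONE copy:

* `su3Basis` — the explicit basis `X_0,…,X_7` of `su(3)` used in the registered stub `stub_currentRigidity`
  (three real rotations, three imaginary symmetric, two diagonal);
* `fwdHop μ = Γ₅ · (−½)(1 − γ_μ)`, `bwdHop μ = Γ₅ · (−½)(1 + γ_μ)` — the spin parts of the two hopping blocks of the
  Hermitian Wilson–Dirac operator `Γ₅ D_W(·, m₀, 1)` (tree `wilsonDirac`, forward-hop convention);
* `LinkData = (ℤ⁴ × Fin 4 → SU3)` — link variables read around a site (the argument type of `bad` in the stub), and
  `BallField R` — colour–spinor fields on the ball `box 4 (R+1) ⊂ ℤ⁴` (a FINITE index type), with the zero-extended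
  accessor `ballVal`;
* `ballApply m₀ w φ y a α` — `(Γ₅ D_W φ)(y,a,α)` on `ℤ⁴` with link data `w` (only neighbours of `y` are read);
  `residualSq R m₀ lam w φ = Σ_{y ∈ box R} ‖(Γ₅D_W − lam)φ (y)‖²` — the squared defect of the eigen-equation on the cube;
  `ballCurrent w φ y μ i` — the colour current of `φ` through the link `(y, μ)` in the direction `X_i`, VERBATIM the
  current of `stub_currentRigidity` with `x + proj y ↦ y`; `currentSum R w φ = Σ_{y ∈ box R, μ, i} |ballCurrent|`;
  `ballNormSq R φ = Σ_{y ∈ box (R+1)} ‖φ y‖²`;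
* `badR R w` — THE MIN-FUNCTIONAL: the infimum of `currentSum + residualSq` over masses `m₀ ∈ [−1,0]`, energies
  `lam ∈ [−1,1]` and unit fields on the ball.  By construction the rigidity inequality (ii) of `stub_currentRigidity`
  holds for `bad := badR R` with `c₀ = 1`, `k = 1` (stub `stub_badRigidity`), `badR` is continuous and `≥ 0`
  (stub `stub_badContinuous`), and the crux is reduced to the saturated Haar small-ball estimate for `badR`
  (stub `stub_badSmallBall`, THE BET): `Haar{V : ∃ g, badR R (V[e₀ ↦ g] read around x) < δ} ≤ C_B δ^m`, `m > 1`.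
  Equation count (Lines/Sketch.md gen 2): `badR R` vanishes identically for `R ≤ 4` (admissible currentless fields
  exist: the boundary layer has more freedom than the current conditions remove) and is generically positive for
  `R ≥ 5` (excess ≈ 54 000 real equations); so `R = 5` is the intended radius.

No statement of the route is asserted here; these are abbreviations only.  Written by the line lead
(prover-line-stmt-QuantumFields-8966-c2-0).
-/

noncomputable section

namespace Summit.QuantumFields.QCD.Cruxes.WegnerEstimate.ResolventCell

open scoped BigOperators Matrix
open Literature.MathematicalPhysics.QuantumLattice Literature.MathematicalPhysics.QuantumFieldTheory
  Literature.Probability.LatticeModels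

/-- The explicit basis `X_0, …, X_7` of `su(3)` (anti-Hermitian, traceless): three real rotations, three imaginary
symmetric off-diagonal, two imaginary diagonal — the list written inline in `stub_currentRigidity`. -/
def su3Basis : Fin 8 → Matrix (Fin 3) (Fin 3) ℂ :=
  ![!![0, 1, 0; -1, 0, 0; 0, 0, 0], !![0, 0, 1; 0, 0, 0; -1, 0, 0],
    !![0, 0, 0; 0, 0, 1; 0, -1, 0], !![0, Complex.I, 0; Complex.I, 0, 0; 0, 0, 0],
    !![0, 0, Complex.I; 0, 0, 0; Complex.I, 0, 0],
    !![0, 0, 0; 0, 0, Complex.I; 0, Complex.I, 0],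
    !![Complex.I, 0, 0; 0, -Complex.I, 0; 0, 0, 0],
    !![0, 0, 0; 0, Complex.I, 0; 0, 0, -Complex.I]]

/-- Spin part of the FORWARD hopping block of `Γ₅ D_W(·, m₀, 1)`: `Γ₅ · (−½)(1 − γ_μ)` (to the neighbour `y + μ̂`,
colour part `w(y, μ)`). -/
def fwdHop (μ : Fin 4) : Matrix (Fin 4) (Fin 4) ℂ :=
  gammaFive * ((-(1 / 2 : ℂ)) • ((1 : Matrix (Fin 4) (Fin 4) ℂ) - euclideanGamma μ))

/-- Spin part of the BACKWARD hopping block of `Γ₅ D_W(·, m₀, 1)`: `Γ₅ · (−½)(1 + γ_μ)` (to the neighbour `y − μ̂`,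
colour part `w(y − μ̂, μ)⁻¹`). -/
def bwdHop (μ : Fin 4) : Matrix (Fin 4) (Fin 4) ℂ :=
  gammaFive * ((-(1 / 2 : ℂ)) • ((1 : Matrix (Fin 4) (Fin 4) ℂ) + euclideanGamma μ))

/-- Link variables read around a site: an element of `SU(3)` for every link `(y, μ)` of `ℤ⁴`
(the argument type of `bad` in `stub_currentRigidity`; a torus configuration `W` is read around `x` as
`l ↦ W (x + proj l.1, l.2)`). -/
abbrev LinkData : Type := (Fin 4 → ℤ) × Fin 4 → SU3

/-- Colour–spinor fields on the ball `box 4 (R+1) ⊂ ℤ⁴` (finite index type). -/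
abbrev BallField (R : ℕ) : Type := ↥(box 4 (R + 1)) × Fin 3 × Fin 4 → ℂ

/-- The zero-extended value of a ball field at an arbitrary site of `ℤ⁴`. -/
def ballVal {R : ℕ} (φ : BallField R) (y : Fin 4 → ℤ) (a : Fin 3) (α : Fin 4) : ℂ :=
  if h : y ∈ box 4 (R + 1) then φ (⟨y, h⟩, a, α) else 0

/-- `(Γ₅ D_W φ)(y, a, α)` on `ℤ⁴` with link data `w` and bare mass `m₀` (Wilson parameter `1`): the on-site term
`(m₀ + 4) Γ₅` plus the eight hops (tree conventions of `wilsonDirac`, written out; only the neighbours `y ± μ̂` are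
read, through the zero-extended accessor). -/
def ballApply {R : ℕ} (m₀ : ℝ) (w : LinkData) (φ : BallField R) (y : Fin 4 → ℤ) (a : Fin 3) (α : Fin 4) : ℂ :=
  ((m₀ + 4 : ℝ) : ℂ) * (∑ γ : Fin 4, gammaFive α γ * ballVal φ y a γ) +
    ∑ μ : Fin 4, ∑ b : Fin 3, ∑ β : Fin 4,
      (fwdHop μ α β * ((w (y, μ) : SU3) : Matrix (Fin 3) (Fin 3) ℂ) a b *
          ballVal φ (y + Pi.single μ 1) b β +
        bwdHop μ α β * (((w (y - Pi.single μ 1, μ))⁻¹ : SU3) : Matrix (Fin 3) (Fin 3) ℂ) a b *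
          ballVal φ (y - Pi.single μ 1) b β)

/-- Squared defect of the eigen-equation `(Γ₅ D_W − lam) φ = 0` on the cube `box 4 R`. -/
def residualSq (R : ℕ) (m₀ lam : ℝ) (w : LinkData) (φ : BallField R) : ℝ :=
  ∑ y ∈ box 4 R, ∑ a : Fin 3, ∑ α : Fin 4, ‖ballApply m₀ w φ y a α - (lam : ℂ) * ballVal φ y a α‖ ^ 2

/-- The colour current of `φ` through the link `(y, μ)` in the direction `X_i` — verbatim the current of
`stub_currentRigidity` with `x + proj y ↦ y` (Hellmann–Feynman derivative of the eigenvalue along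
`w(y, μ) ↦ w(y, μ) exp(t X_i)`). -/
def ballCurrent {R : ℕ} (w : LinkData) (φ : BallField R) (y : Fin 4 → ℤ) (μ : Fin 4) (i : Fin 8) : ℝ :=
  2 * (∑ a : Fin 3, ∑ b : Fin 3, ∑ α : Fin 4, ∑ β : Fin 4,
      star (ballVal φ y a α) * fwdHop μ α β *
        (((w (y, μ) : SU3) : Matrix (Fin 3) (Fin 3) ℂ) * su3Basis i) a b *
        ballVal φ (y + Pi.single μ 1) b β).re

/-- Total absolute current of `φ` through the links based in the cube `box 4 R`, all eight directions. -/
def currentSum (R : ℕ) (w : LinkData) (φ : BallField R) : ℝ :=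
  ∑ y ∈ box 4 R, ∑ μ : Fin 4, ∑ i : Fin 8, |ballCurrent w φ y μ i|

/-- Squared ℓ²-norm of a ball field (all sites of `box 4 (R+1)`). -/
def ballNormSq (R : ℕ) (φ : BallField R) : ℝ :=
  ∑ p : ↥(box 4 (R + 1)) × Fin 3 × Fin 4, ‖φ p‖ ^ 2

/-- THE MIN-FUNCTIONAL `bad_R(w)`: the infimum over `m₀ ∈ [−1, 0]`, `lam ∈ [−1, 1]` and unit ball fields of
`currentSum + residualSq`.  It vanishes iff some unit field on the ball solves the eigen-equation on the cube with ALL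
cube currents zero (an "admissible currentless field"); for the pull-back of a genuine torus eigenvector the residual
vanishes, which gives the rigidity inequality `Σ|J| ≥ bad_R · ‖φ‖²` for free (`stub_badRigidity`). -/
def badR (R : ℕ) (w : LinkData) : ℝ :=
  sInf {r : ℝ | ∃ (m₀ lam : ℝ) (φ : BallField R), -1 ≤ m₀ ∧ m₀ ≤ 0 ∧ |lam| ≤ 1 ∧ ballNormSq R φ = 1 ∧
    r = currentSum R w φ + residualSq R m₀ lam w φ}

/-- `currentSum ≥ 0` (a sum of absolute values). -/
theorem currentSum_nonneg (R : ℕ) (w : LinkData) (φ : BallField R) : 0 ≤ currentSum R w φ :=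
  Finset.sum_nonneg fun _ _ => Finset.sum_nonneg fun _ _ => Finset.sum_nonneg fun _ _ => abs_nonneg _

/-- `residualSq ≥ 0` (a sum of squared norms). -/
theorem residualSq_nonneg (R : ℕ) (m₀ lam : ℝ) (w : LinkData) (φ : BallField R) : 0 ≤ residualSq R m₀ lam w φ :=
  Finset.sum_nonneg fun _ _ => Finset.sum_nonneg fun _ _ => Finset.sum_nonneg fun _ _ => by positivity

/-- **The min-functional is non-negative** (every element of the set under the infimum is a `currentSum + residualSq`). -/
theorem badR_nonneg (R : ℕ) (w : LinkData) : 0 ≤ badR R w := by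
  refine Real.sInf_nonneg ?_
  rintro r ⟨m₀, lam, φ, -, -, -, -, rfl⟩
  exact add_nonneg (currentSum_nonneg R w φ) (residualSq_nonneg R m₀ lam w φ)

/-! ## Gen 2c: the JUNK-FREE port functional (supersedes `badR`)

WARNING (lead c2, 2026-08-17): `badR R` above is IDENTICALLY ZERO — a ball field supported on ONE site of the outer
layer `box (R+1) \ box R` has zero residual on the cube and zero currents, and unit norm — so the gen-2b stubs over
`badR` are vacuous (`stub_badRigidity`) resp. false (`stub_badSmallBall`).  The corrected functional below lives on
the sites of the cube `box 4 R` with AT MOST TWO extreme coordinates (`portDomain R`: the cube's interior `box (R−1)`,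
its faces and its 2-edges; the 3-edges and corners carry no equation and are dropped), imposes the FULL eigen-equation
on `box (R−1)`, the PORT-PROJECTED eigen-equation at the faces (the one unknown outward neighbour of a face enters only
through `ran(Γ₅ P_∓^μ) ⊗ ℂ³`, which `P_∓^μ` annihilates), all colour currents on links inside the cube, and normalises
by the full ℓ²-norm on `portDomain R` (a compact sphere).  No non-zero field on `portDomain R` is invisible to every
term (isolated faces: inward residual + port; isolated 2-edges: the two adjacent ports, whose spin parts
`P_+^ν P_-^μ`, `P_+^μ P_-^ν` have trivial common kernel for every colour datum).  Equation count (worst support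
pattern, Lines/Sketch.md §gen 2c): excess ≈ 790 at `R = 2`, comfortable at `R = 3`. -/

/-- `(Γ₅ D_W v)(y, a, α)` on `ℤ⁴` for an arbitrary (zero-extended) field `v : ℤ⁴ → Fin 3 → Fin 4 → ℂ`, link data `w`,
bare mass `m₀`, Wilson parameter `1` (the landed `ballApply` is `latticeApply` applied to `ballVal φ`). -/
def latticeApply (m₀ : ℝ) (w : LinkData) (v : (Fin 4 → ℤ) → Fin 3 → Fin 4 → ℂ) (y : Fin 4 → ℤ) (a : Fin 3)
    (α : Fin 4) : ℂ :=
  ((m₀ + 4 : ℝ) : ℂ) * (∑ γ : Fin 4, gammaFive α γ * v y a γ) +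
    ∑ μ : Fin 4, ∑ b : Fin 3, ∑ β : Fin 4,
      (fwdHop μ α β * ((w (y, μ) : SU3) : Matrix (Fin 3) (Fin 3) ℂ) a b * v (y + Pi.single μ 1) b β +
        bwdHop μ α β * (((w (y - Pi.single μ 1, μ))⁻¹ : SU3) : Matrix (Fin 3) (Fin 3) ℂ) a b *
          v (y - Pi.single μ 1) b β)

/-- The colour current of a (zero-extended) field `v` through the link `(y, μ)` in the direction `X_i` —
verbatim the current of `stub_currentRigidity` with `x + proj y ↦ y`. -/
def latticeCurrent (w : LinkData) (v : (Fin 4 → ℤ) → Fin 3 → Fin 4 → ℂ) (y : Fin 4 → ℤ) (μ : Fin 4) (i : Fin 8) : ℝ :=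
  2 * (∑ a : Fin 3, ∑ b : Fin 3, ∑ α : Fin 4, ∑ β : Fin 4,
      star (v y a α) * fwdHop μ α β * (((w (y, μ) : SU3) : Matrix (Fin 3) (Fin 3) ℂ) * su3Basis i) a b *
        v (y + Pi.single μ 1) b β).re

/-- Number of coordinates of `y` on the boundary of the cube of radius `R` (`|y μ| = R`). -/
def extremeCount (R : ℕ) (y : Fin 4 → ℤ) : ℕ :=
  (Finset.univ.filter fun μ : Fin 4 => |y μ| = (R : ℤ)).card

/-- The PORT DOMAIN: sites of `box 4 R` with at most two extreme coordinates (interior, faces, 2-edges). -/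
def portDomain (R : ℕ) : Finset (Fin 4 → ℤ) :=
  (box 4 R).filter fun y => extremeCount R y ≤ 2

/-- The FACES of the cube: sites of `box 4 R` with exactly one extreme coordinate. -/
def portFaces (R : ℕ) : Finset (Fin 4 → ℤ) :=
  (box 4 R).filter fun y => extremeCount R y = 1

/-- The port projector at a site (spin part): `½(1 − γ_μ)` if `y μ = R`, `½(1 + γ_μ)` if `y μ = −R`, summed over
`μ` (exactly one summand is active at a face); it annihilates the contribution `ran(Γ₅ P_∓^μ)` of the one outward
hop of a face site. -/
def portProj (R : ℕ) (y : Fin 4 → ℤ) : Matrix (Fin 4) (Fin 4) ℂ :=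
  ∑ μ : Fin 4,
    ((if y μ = (R : ℤ) then (1 / 2 : ℂ) • ((1 : Matrix (Fin 4) (Fin 4) ℂ) - euclideanGamma μ) else 0) +
      (if y μ = -(R : ℤ) then (1 / 2 : ℂ) • ((1 : Matrix (Fin 4) (Fin 4) ℂ) + euclideanGamma μ) else 0))

/-- Colour–spinor fields on the port domain (finite index type). -/
abbrev PortField (R : ℕ) : Type := ↥(portDomain R) × Fin 3 × Fin 4 → ℂ

/-- The zero-extended value of a port field at an arbitrary site of `ℤ⁴`. -/
def portVal {R : ℕ} (φ : PortField R) (y : Fin 4 → ℤ) (a : Fin 3) (α : Fin 4) : ℂ :=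
  if h : y ∈ portDomain R then φ (⟨y, h⟩, a, α) else 0

/-- Squared defect of the FULL eigen-equation on the interior cube `box 4 (R − 1)`. -/
def portInteriorResSq (R : ℕ) (m₀ lam : ℝ) (w : LinkData) (φ : PortField R) : ℝ :=
  ∑ y ∈ box 4 (R - 1), ∑ a : Fin 3, ∑ α : Fin 4,
    ‖latticeApply m₀ w (portVal φ) y a α - (lam : ℂ) * portVal φ y a α‖ ^ 2

/-- Squared defect of the PORT-PROJECTED eigen-equation at the faces. -/
def portFaceResSq (R : ℕ) (m₀ lam : ℝ) (w : LinkData) (φ : PortField R) : ℝ :=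
  ∑ y ∈ portFaces R, ∑ a : Fin 3, ∑ α : Fin 4,
    ‖∑ β : Fin 4, portProj R y α β * (latticeApply m₀ w (portVal φ) y a β - (lam : ℂ) * portVal φ y a β)‖ ^ 2

/-- Total absolute current through the links based in the cube `box 4 R` (links leaving the port domain contribute `0`,
since the field is zero-extended there). -/
def portCurrentSum (R : ℕ) (w : LinkData) (φ : PortField R) : ℝ :=
  ∑ y ∈ box 4 R, ∑ μ : Fin 4, ∑ i : Fin 8, |latticeCurrent w (portVal φ) y μ i|

/-- Squared ℓ²-norm of a port field. -/
def portNormSq (R : ℕ) (φ : PortField R) : ℝ :=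
  ∑ p : ↥(portDomain R) × Fin 3 × Fin 4, ‖φ p‖ ^ 2

/-- THE JUNK-FREE MIN-FUNCTIONAL `bad^port_R(w)`: the infimum over `m₀ ∈ [−1,0]`, `lam ∈ [−1,1]` and unit port fields of
`portCurrentSum + portInteriorResSq + portFaceResSq`.  For the restriction to `portDomain R` of a genuine torus
eigenvector both residuals vanish (port projection kills the outward hop), so `Σ_cell |J| ≥ bad^port_R · ‖φ‖²` for free. -/
def badPort (R : ℕ) (w : LinkData) : ℝ :=
  sInf {r : ℝ | ∃ (m₀ lam : ℝ) (φ : PortField R), -1 ≤ m₀ ∧ m₀ ≤ 0 ∧ |lam| ≤ 1 ∧ portNormSq R φ = 1 ∧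
    r = portCurrentSum R w φ + portInteriorResSq R m₀ lam w φ + portFaceResSq R m₀ lam w φ}

/-- `portCurrentSum ≥ 0`. -/
theorem portCurrentSum_nonneg (R : ℕ) (w : LinkData) (φ : PortField R) : 0 ≤ portCurrentSum R w φ :=
  Finset.sum_nonneg fun _ _ => Finset.sum_nonneg fun _ _ => Finset.sum_nonneg fun _ _ => abs_nonneg _

/-- `portInteriorResSq ≥ 0`. -/
theorem portInteriorResSq_nonneg (R : ℕ) (m₀ lam : ℝ) (w : LinkData) (φ : PortField R) :
    0 ≤ portInteriorResSq R m₀ lam w φ :=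
  Finset.sum_nonneg fun _ _ => Finset.sum_nonneg fun _ _ => Finset.sum_nonneg fun _ _ => by positivity

/-- `portFaceResSq ≥ 0`. -/
theorem portFaceResSq_nonneg (R : ℕ) (m₀ lam : ℝ) (w : LinkData) (φ : PortField R) :
    0 ≤ portFaceResSq R m₀ lam w φ :=
  Finset.sum_nonneg fun _ _ => Finset.sum_nonneg fun _ _ => Finset.sum_nonneg fun _ _ => by positivity

/-- **The junk-free min-functional is non-negative.** -/
theorem badPort_nonneg (R : ℕ) (w : LinkData) : 0 ≤ badPort R w := by
  refine Real.sInf_nonneg ?_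
  rintro r ⟨m₀, lam, φ, -, -, -, -, rfl⟩
  exact add_nonneg (add_nonneg (portCurrentSum_nonneg R w φ) (portInteriorResSq_nonneg R m₀ lam w φ))
    (portFaceResSq_nonneg R m₀ lam w φ)

/-! ## Gen 3 (lead c3, 2026-08-17): `badPort R` VANISHES IDENTICALLY — the collective 2-edge junk witnesses

WARNING (lead c3): the gen-2c functional `badPort R` above is ALSO identically zero, for every `R`.  A single
2-edge value is killed by the port equations of its two inward faces, but TWO 2-edge sites sharing an inward face
are not: `z₁ = (R, R, R−1, R−1)` and `z₂ = (R, R−1, R, R−1)` are seen only by the faces `f₁ = (R, R−1, R−1, R−1)`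
(both), `f₂ = (R−1, R, R−1, R−1)` (`z₁`) and `f₃ = (R−1, R−1, R, R−1)` (`z₂`) — 24 complex unknowns against
3 × 6 port equations — are not joined by a link (no current) and are not neighbours of `box (R−1)` (no interior
residual).  Explicit kernel element: `φ(z₁) = c ⊗ s`, `φ(z₂) = −(W(f₁,2)⁻¹ W(f₁,1) c) ⊗ s` with
`s = (1, 0, 0, i)` the `+1` eigenvector of `γ₀` and `c ∈ ℂ³` arbitrary.  The objects are named here (single
source for the proof files `…WegnerEstimateBadPortJunkGeometry.lean`, `…WegnerEstimateBadPortVanishes.lean`, which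
prove `badPort_eq_zero : ∀ R w, badPort R w = 0` and `not_portSmallBall`, the negation of the registered
`stub_portSmallBall`).  Moral for the next formulation: rigidity must be normalised by INTERIOR mass
(`box R'`, `R' ≤ R − 2`); every compact local min-functional normalised on its own domain dies on boundary junk. -/

/-- The junk spinor `s = (1, 0, 0, i)`: the `+1` eigenvector of `γ₀` in the tree's chiral basis
(`(1 − γ₀) s = 0`, so the direction-`0` forward hop `Γ₅ (−½)(1 − γ₀)` kills it). -/
def junkSpinor : Fin 4 → ℂ := ![1, 0, 0, Complex.I]

/-- The first junk site `z₁ = (R, R, R−1, R−1)` (a 2-edge of the cube of radius `R`). -/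
def junkSite₁ (R : ℕ) : Fin 4 → ℤ := ![(R : ℤ), R, R - 1, R - 1]

/-- The second junk site `z₂ = (R, R−1, R, R−1)` (a 2-edge sharing the inward face `f₁` with `z₁`). -/
def junkSite₂ (R : ℕ) : Fin 4 → ℤ := ![(R : ℤ), R - 1, R, R - 1]

/-- The shared face `f₁ = (R, R−1, R−1, R−1)` (`f₁ + e₁ = z₁`, `f₁ + e₂ = z₂`). -/
def junkFace₁ (R : ℕ) : Fin 4 → ℤ := ![(R : ℤ), R - 1, R - 1, R - 1]

/-- The private face `f₂ = (R−1, R, R−1, R−1)` of `z₁` (`f₂ + e₀ = z₁`). -/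
def junkFace₂ (R : ℕ) : Fin 4 → ℤ := ![(R : ℤ) - 1, R, R - 1, R - 1]

/-- The private face `f₃ = (R−1, R−1, R, R−1)` of `z₂` (`f₃ + e₀ = z₂`). -/
def junkFace₃ (R : ℕ) : Fin 4 → ℤ := ![(R : ℤ) - 1, R - 1, R, R - 1]

/-- The support predicate of the junk field: `y` is one of the two junk sites. -/
def IsJunkSite (R : ℕ) (y : Fin 4 → ℤ) : Prop := y = junkSite₁ R ∨ y = junkSite₂ R

/-- Colour amplitude of the junk field: `c` at `z₁`, `−W(f₁,2)⁻¹ W(f₁,1) c` at `z₂` (so that the two forward hops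
into the shared face `f₁` cancel in colour), zero elsewhere. -/
def junkColour (R : ℕ) (w : LinkData) (c : Fin 3 → ℂ) (y : Fin 4 → ℤ) : Fin 3 → ℂ :=
  if y = junkSite₁ R then c
  else if y = junkSite₂ R then
    -((((w (junkFace₁ R, 2))⁻¹ * w (junkFace₁ R, 1) : SU3) : Matrix (Fin 3) (Fin 3) ℂ) *ᵥ c)
  else 0

/-- The junk field on the port domain: `junkColour ⊗ junkSpinor` (a port-admissible currentless field for every
link datum, every `m₀`, every `λ`; `…BadPortVanishes.lean`). -/
def junkField (R : ℕ) (w : LinkData) (c : Fin 3 → ℂ) : PortField R :=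
  fun p => junkColour R w c (p.1 : Fin 4 → ℤ) p.2.1 * junkSpinor p.2.2

/-! ## Gen 4 (lead c4, 2026-08-17): the INTERIOR-normalised functional `badStar` and its continuous envelope `badEnv`

The moral of gens 2b/2c/3 is that NO compact normalisation survives: in the ball vocabulary of gen 2b the invisible
outer components and — decisively — the face-sharing 2-edge pairs of the NEGATIVE corner of the cube (`36` real
port-projected face equations against `48` real unknowns, and no cell current because the links entering those sites
are exterior) give, for EVERY link datum, residual-free currentless fields of unit norm supported in the boundary layer.
All of them have ZERO mass on the interior cube `box 4 R'`, `R' ≤ R − 1`.  So the honest functional is gen 2b's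
`currentSum + residualSq` on `BallField R`, normalised by the INTERIOR mass `ballBoxMass R R' φ = 1` (`badStar`, written
`bad⋆` in Lines/Sketch.md).  The price is compactness: `badStar` is an infimum over a NON-compact set, hence only upper
semicontinuous in `w` a priori (an infimum of continuous functions), while the registered `stub_currentRigidity` asks for a
CONTINUOUS `bad`.  The repair costs nothing: the McShane/Lipschitz ENVELOPE
`badEnv R R' w = inf_{w'} [badStar R R' w' + linkCost R w w']` (`linkCost` = the `ℓ¹` distance of the matrix entries of
the links based in `box 4 (R+1)`, a superset of the links `badStar` reads) is continuous (it is `1`-Lipschitz for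
`linkCost`), is a MINORANT of `badStar` (take `w' = w`), so the tautological rigidity
`Σ_cell |J(ψ)| ≥ badStar · (mass of ψ on x + box R') ≥ badEnv · (mass …)` survives, and its sublevel set `{badEnv < δ}`
lies in the `δ`-tube (for `linkCost`) of `{badStar < δ}`, so the saturated Haar small-ball estimate — THE BET of the line,
now about an explicit, continuous, non-negative function — is the same statement up to constants.  Junk-corrected equation
count (lead c4, PICKED.md): residual-free currentless fields with interior mass are generically ABSENT already at `R = 2`
(excess `+6376` real equations, no negative support pattern found; at `R = 1` the star pattern has excess `−40`, c2's
40-dimensional family), so the intended radii are `(R, R') = (2, 1)`; numerics N10 (kit, attached to the item) test it.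
No statement of the route is asserted here; abbreviations and their order-zero sanity lemmas only. -/

/-- Interior mass of a ball field: `Σ_{y ∈ box 4 R'} Σ_{a, α} ‖φ(y, a, α)‖²`, read through the zero-extended accessor
(so every `R'` is allowed; the intended use is `R' ≤ R − 1`, where all boundary junk has mass `0`). -/
def ballBoxMass (R R' : ℕ) (φ : BallField R) : ℝ :=
  ∑ y ∈ box 4 R', ∑ a : Fin 3, ∑ α : Fin 4, ‖ballVal φ y a α‖ ^ 2

/-- THE INTERIOR-NORMALISED MIN-FUNCTIONAL `bad⋆_{R,R'}(w)`: the infimum over `m₀ ∈ [−1, 0]`, `lam ∈ [−1, 1]` and ball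
fields of interior mass `ballBoxMass R R' φ = 1` of `currentSum R w φ + residualSq R m₀ lam w φ`.  For the pull-back of a
genuine torus eigenvector the residual vanishes on the cube, so `Σ_cell |J| ≥ bad⋆ · (mass on x + box R')` for free; the
functional vanishes at `w` iff interior-massive admissible fields come arbitrarily close to being currentless. -/
def badStar (R R' : ℕ) (w : LinkData) : ℝ :=
  sInf {r : ℝ | ∃ (m₀ lam : ℝ) (φ : BallField R), -1 ≤ m₀ ∧ m₀ ≤ 0 ∧ |lam| ≤ 1 ∧ ballBoxMass R R' φ = 1 ∧
    r = currentSum R w φ + residualSq R m₀ lam w φ}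

/-- The `ℓ¹` entrywise distance between two link data on the links based in `box 4 (R+1)` (a superset of the links read by
`badStar R R'`: `ballApply` on `box 4 R` reads `w(y, μ)` and `w(y − μ̂, μ)`, `ballCurrent` reads `w(y, μ)`). -/
def linkCost (R : ℕ) (w w' : LinkData) : ℝ :=
  ∑ y ∈ box 4 (R + 1), ∑ μ : Fin 4, ∑ a : Fin 3, ∑ b : Fin 3,
    ‖((w (y, μ) : SU3) : Matrix (Fin 3) (Fin 3) ℂ) a b - ((w' (y, μ) : SU3) : Matrix (Fin 3) (Fin 3) ℂ) a b‖

/-- THE CONTINUOUS ENVELOPE `badEnv_{R,R'}(w) = inf_{w'} [bad⋆_{R,R'}(w') + linkCost_R(w, w')]` (McShane minorant): continuous,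
`0 ≤ badEnv ≤ badStar`, and `{badEnv < δ}` lies in the `δ`-tube of `{badStar < δ}`.  This is the witness `bad` of
`stub_currentRigidity` in the gen-4 skeleton (`k = 1`, `c₀ = 1`). -/
def badEnv (R R' : ℕ) (w : LinkData) : ℝ :=
  sInf {r : ℝ | ∃ w' : LinkData, r = badStar R R' w' + linkCost R w w'}

/-- Interior mass is non-negative. -/
theorem ballBoxMass_nonneg (R R' : ℕ) (φ : BallField R) : 0 ≤ ballBoxMass R R' φ :=
  Finset.sum_nonneg fun _ _ => Finset.sum_nonneg fun _ _ => Finset.sum_nonneg fun _ _ => by positivity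

/-- **The interior-normalised min-functional is non-negative.** -/
theorem badStar_nonneg (R R' : ℕ) (w : LinkData) : 0 ≤ badStar R R' w := by
  refine Real.sInf_nonneg ?_
  rintro r ⟨m₀, lam, φ, -, -, -, -, rfl⟩
  exact add_nonneg (currentSum_nonneg R w φ) (residualSq_nonneg R m₀ lam w φ)

/-- The link cost is non-negative. -/
theorem linkCost_nonneg (R : ℕ) (w w' : LinkData) : 0 ≤ linkCost R w w' :=
  Finset.sum_nonneg fun _ _ => Finset.sum_nonneg fun _ _ => Finset.sum_nonneg fun _ _ =>
    Finset.sum_nonneg fun _ _ => norm_nonneg _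

/-- The link cost of a datum to itself is `0`. -/
theorem linkCost_self (R : ℕ) (w : LinkData) : linkCost R w w = 0 := by
  simp [linkCost]

/-- **The envelope is non-negative.** -/
theorem badEnv_nonneg (R R' : ℕ) (w : LinkData) : 0 ≤ badEnv R R' w := by
  refine Real.sInf_nonneg ?_
  rintro r ⟨w', rfl⟩
  exact add_nonneg (badStar_nonneg R R' w') (linkCost_nonneg R w w')

/-- **The envelope is a minorant**: `badEnv ≤ badStar` (take `w' = w`). -/
theorem badEnv_le_badStar (R R' : ℕ) (w : LinkData) : badEnv R R' w ≤ badStar R R' w := by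
  refine csInf_le ⟨0, ?_⟩ ⟨w, by rw [linkCost_self, add_zero]⟩
  rintro r ⟨w', rfl⟩
  exact add_nonneg (badStar_nonneg R R' w') (linkCost_nonneg R w w')

end Summit.QuantumFields.QCD.Cruxes.WegnerEstimate.ResolventCell

end
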